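import Summits.ValiantsHypothesis.ValiantsHypothesis.Theses.ProjectionStability
import Summits.ValiantsHypothesis.ValiantsHypothesis.Theses.ProjectionRigidity
import Literature.Computability.AlgebraicComplexity.DeterminantalComplexityProofs
import Literature.Computability.Complexity.OccurrenceObstructionsFresh
import Literature.LinearAlgebra.Matrix.PermanentSubperm
import Literature.Computability.AlgebraicComplexity.QuasiPolynomialFormulas
import Summits.ValiantsHypothesis.ValiantsHypothesis.Theorems.DetqpThesis.Negative.IffPerNotVQP

/-!
# Disproof of `PdcQpOfVp` (stmt-ValiantsHypothesis-16003) — findings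

Crux (shared by `Theses.ProjectionStability` / `Theses.ProjectionRigidity`, equal by `rfl`):

  `IsVPFamily (n ↦ per_n) → IsQPBounded (n ↦ pdc(per_n))`,  `pdc = detProjectionComplexity`.

VERDICT OF CYCLE 1 (cdisprove, 2026-08-17): **NO KILL — the crux is a theorem.**
* It is known mathematics (Valiant 1979 Thm 1; BCS 1997 Cor. (21.40); Bürgisser 2000 Prop. 2.30)
  and a complete sorry-free candidate proof is attached to the item as evidence
  (`Proof.lean` v2 by refuter-rattack, 2026-08-17T05:22Z: birth line with both registered stubs
  proved; std axioms).  A `¬ PdcQpOfVp` would make the tree inconsistent.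
* READ-BACK (W.lean rc 0): `IsVPFamily = IsPFamily ∧ IsPBounded (n ↦ complexity per_n)`;
  `IsQPBounded t = ∃ c, ∀ n, t n ≤ 2 ^ ((Nat.log 2 n + c) ^ c)` (∃∀ order = Bürgisser Def. 2.26);
  `pdc f = sInf {m | IsProjection f (detPoly (Fin m) ℂ)}`.  The only junk (`sInf ∅ = 0`) LOWERS
  `pdc`, so it cannot falsify an upper bound; small `n` are absorbed by the constant `c`
  (`pdc(per_0) = 0`, `pdc(per_1) = 1`, `pdc(per_2) = 3` below — no junk at small `n`).
* (a) LOAD-BEARING ANALYSIS.  The crux has ONE hypothesis, `IsVPFamily per` (of which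
  `IsPFamily per` is true outright, so the content is `IsPComputable per`, i.e. `¬VH`-strength).
  Dropping it leaves `PdcQpOfVpWithoutVP := IsQPBounded (n ↦ pdc(per_n))`, i.e. "per is a
  qp-projection of DET" = `per ∈ VQP`; its NEGATION is EQUIVALENT to Bürgisser's extended
  Valiant hypothesis `ExtendedValiantHypothesis ℂ = ¬ (VNP ℂ ⊆ VQP ℂ)` (BCS97 (21.32)/(21.41)):
  (←) `not_withoutVP_of_extendedValiantHypothesis` below (landed `DetqpThesis/Negative/IffPerNotVQP`
  + `dc ≤ pdc`); (→) via `pdc ≤ (n²+1)·dc` (= stub 1 / evidence Proof.lean, not re-proved here).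
  OPEN either way, so `pdcQpOfVp_false_without_VP` CANNOT be landed unconditionally: "any proof
  must use VP-ness of per" is exactly as credible as EVH.
* (b)/(c) BOUNDARY LEMMAS for the picked line `birth` (stub `stub_isDetProjection_of_hasDetRepr :
  HasDetRepr f m → IsDetProjection f ((#σ+1)·m)`): the size blow-up is NECESSARY —
  `HasDetRepr f m → IsDetProjection f m` is FALSE (witness `f = per_2`, `m = 2`:
  `dc(per_2) = 2 < 3 = pdc(per_2)`), and the natural strengthening "pdc(per_n) = dc(per_n) for
  every n" (true at n = 0, 1, 3) FAILS at n = 2.  All sorry-free below: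
  `detProjectionComplexity_perPoly_two : pdc(per_2) = 3`, `not_isDetProjection_of_hasDetRepr_sameSize`,
  `not_forall_pdc_eq_dc_perPoly`.
* (c') strengthening `IsVPFamily per → IsPBounded (n ↦ pdc(per_n))` (polynomial instead of
  quasi-polynomial) = "VP ⊆ VBP on the permanent": open (VP vs VBP), no finite falsifier.
* (d) Targets: none (payload `stuck_stubs = []`; both registered stubs are TRUE as stated:
  stub 2 proved in evidence `Stub2Proof.lean`, stub 1 proved inside `Proof.lean`).
WHY IT RESISTS: it is exactly the known theorem; every mutation that would make it false
(drop VP; polynomial bound) turns it into an OPEN problem, not a refutable one.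

LANDED (importable, p146455 ACCEPTED, commit 7f1485322d64):
`Summits/ValiantsHypothesis/ValiantsHypothesis/Theorems/PdcQpOfVp/Negative/AffineToProjectionBlowup.lean`
(namespace `Summit.ValiantsHypothesis.Theorems.PdcQpOfVp.Negative`): `aeval_detPoly`,
`not_isDetProjection_perPoly_two_of_le_two`, `isDetProjection_perPoly_two_three`,
`detProjectionComplexity_perPoly_two / _zero / _one`, `stub_isDetProjection_of_hasDetRepr_false_at_same_size`,
`not_forall_pdc_eq_dc_perPoly`, `not_isQPBounded_pdc_perPoly_of_extendedValiantHypothesis`.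
This work file keeps its own copies (namespace `…Cruxes.PdcQpOfVp.Disproof`).
-/

namespace Summit.ValiantsHypothesis.ValiantsHypothesis.Cruxes.PdcQpOfVp.Disproof

set_option linter.dupNamespace false

open MvPolynomial Literature.Computability.AlgebraicComplexity

/-- The two shared copies of the crux agree definitionally. -/
example : Theses.ProjectionStability.PdcQpOfVp = Theses.ProjectionRigidity.PdcQpOfVp := rfl

/-! ## (a) Load-bearing analysis: the single hypothesis `IsVPFamily per` -/

/-- The crux with its only hypothesis dropped: `n ↦ pdc(per_n)` is quasi-polynomially bounded,
i.e. the permanent is a qp-projection of the determinant (`per ∈ VQP`, BCS 1997 Cor. (21.40)).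
Its negation is the extended Valiant hypothesis `VNP ⊄ VQP` (Bürgisser 2000, §8.1) — OPEN; so no
`_false_without_VP` lemma can be landed. [cite: Burgisser2000, Def. 2.26 and Cor. 2.28] -/
def PdcQpOfVpWithoutVP : Prop :=
  IsQPBounded (fun n => detProjectionComplexity (perPoly (Fin n) ℂ))

/-- Trivial direction: the hypothesis-free form implies the crux. -/
theorem pdcQpOfVp_of_withoutVP (h : PdcQpOfVpWithoutVP) : Theses.ProjectionStability.PdcQpOfVp :=
  fun _ => h

/-- `dc ≤ pdc` transports a qp bound: the hypothesis-free form refutes the crux `DetQP.DetqpThesis`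
(`¬ IsQPBounded (n ↦ dc(per_n))`). [folklore] -/
theorem isQPBounded_dc_of_withoutVP (h : PdcQpOfVpWithoutVP) :
    IsQPBounded (fun n => determinantalComplexity (perPoly (Fin n) ℂ)) := by
  obtain ⟨c, hc⟩ := h
  exact ⟨c, fun n => (determinantalComplexity_le_detProjectionComplexity_holds _).trans (hc n)⟩

/-- **`_false_without_VP` modulo EVH**: the extended Valiant hypothesis `¬ (VNP ℂ ⊆ VQP ℂ)` refutes
the hypothesis-free form of the crux (via the landed `detqpThesis_iff_extendedValiantHypothesis`
and `dc ≤ pdc`).  The converse also holds (by `pdc ≤ (n²+1)·dc`), so dropping the VP hypothesis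
turns `¬`(crux) into an open conjecture — nothing landable. [cite: BurgisserClausenShokrollahi1997, (21.32) and (21.41)] -/
theorem not_withoutVP_of_extendedValiantHypothesis (hE : ExtendedValiantHypothesis ℂ) :
    ¬ PdcQpOfVpWithoutVP := fun h =>
  (Summit.ValiantsHypothesis.Theorems.DetqpThesis.Negative.detqpThesis_iff_extendedValiantHypothesis.2
    hE) (isQPBounded_dc_of_withoutVP h)

/-! ## Small models: `aeval` of the generic determinant, `per_2`, and `pdc(per_n)` for `n ≤ 2` -/

/-- Substituting `a` into `DET_m` gives the determinant of the substituted matrix. [folklore] -/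
theorem aeval_detPoly {σ : Type*} {m : ℕ} (a : Fin m × Fin m → MvPolynomial σ ℂ) :
    aeval a (detPoly (Fin m) ℂ) = (Matrix.of fun i j => a (i, j)).det := by
  unfold detPoly
  rw [AlgHom.map_det]
  congr 1
  ext i j
  simp [Matrix.mvPolynomialX_apply]

/-- `per_2 = x₀₀ x₁₁ + x₀₁ x₁₀`. [folklore] -/
theorem perPoly_two_eq : perPoly (Fin 2) ℂ = X (0, 0) * X (1, 1) + X (0, 1) * X (1, 0) := by
  simp [perPoly, Matrix.permanent_fin_two_row]

/-- `per_2 (t, t, t, t) = 2t²`. [folklore] -/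
theorem eval_const_perPoly_two (t : ℂ) : eval (fun _ => t) (perPoly (Fin 2) ℂ) = t * t + t * t := by
  rw [perPoly_two_eq]; simp only [map_add, map_mul, eval_X]

/-- **No projection of `DET_m`, `m ≤ 2`, equals `per_2`.**  Proof: restrict the identity
`per_2 = det (a i j)` to the diagonal line `x = (t,t,t,t)`; every entry becomes `t` or a
constant, so the second difference `E(2) - 2E(1) + E(0)` of the right-hand side lies in
`{-2, 0, 2}` while that of `2t²` is `4`. [folklore] -/
theorem not_isDetProjection_perPoly_two_of_le_two {m : ℕ} (hm : m ≤ 2) :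
    ¬ IsDetProjection (perPoly (Fin 2) ℂ) m := by
  rintro ⟨a, ha, heq⟩
  rw [aeval_detPoly] at heq
  have E : ∀ t : ℂ, t * t + t * t = eval (fun _ => t) (Matrix.of fun i j => a (i, j)).det :=
    fun t => by rw [← eval_const_perPoly_two, heq]
  have h0 := E 0
  have h1 := E 1
  have h2 := E 2
  interval_cases m
  · simp only [Matrix.det_isEmpty, map_one] at h0 h1 h2
    have hh : (4 : ℂ) = 0 := by linear_combination h2 - 2 * h1 + h0
    norm_num at hh
  · simp only [Matrix.det_fin_one, Matrix.of_apply] at h0 h1 h2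
    rcases ha (0, 0) with ⟨v, e⟩ | ⟨c, e⟩ <;> simp only [e, eval_X, eval_C] at h0 h1 h2 <;>
    · have hh : (4 : ℂ) = 0 := by linear_combination h2 - 2 * h1 + h0
      norm_num at hh
  · simp only [Matrix.det_fin_two, Matrix.of_apply, map_sub, map_mul] at h0 h1 h2
    rcases ha (0, 0) with ⟨v₀, e₀⟩ | ⟨c₀, e₀⟩ <;> rcases ha (1, 1) with ⟨v₃, e₃⟩ | ⟨c₃, e₃⟩ <;>
      rcases ha (0, 1) with ⟨v₁, e₁⟩ | ⟨c₁, e₁⟩ <;> rcases ha (1, 0) with ⟨v₂, e₂⟩ | ⟨c₂, e₂⟩ <;>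
      simp only [e₀, e₁, e₂, e₃, eval_X, eval_C] at h0 h1 h2 <;>
      first
        | (have hh : (4 : ℂ) = 0 := by linear_combination h2 - 2 * h1 + h0); norm_num at hh
        | (have hh : (2 : ℂ) = 0 := by linear_combination h2 - 2 * h1 + h0); norm_num at hh
        | (have hh : (6 : ℂ) = 0 := by linear_combination h2 - 2 * h1 + h0); norm_num at hh

/-- Grenet's `3 × 3` projection: `per_2 = det [[0, x₀₀, x₀₁], [x₁₁, -1, 0], [x₁₀, 0, -1]]`. [folklore] -/
theorem isDetProjection_perPoly_two_three : IsDetProjection (perPoly (Fin 2) ℂ) 3 := by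
  let M : Matrix (Fin 3) (Fin 3) (MvPolynomial (Fin 2 × Fin 2) ℂ) :=
    !![C 0, X (0, 0), X (0, 1); X (1, 1), C (-1), C 0; X (1, 0), C 0, C (-1)]
  refine ⟨fun p => M p.1 p.2, fun p => ?_, ?_⟩
  · obtain ⟨i, j⟩ := p
    fin_cases i <;> fin_cases j
    · exact Or.inr ⟨0, rfl⟩
    · exact Or.inl ⟨(0, 0), rfl⟩
    · exact Or.inl ⟨(0, 1), rfl⟩
    · exact Or.inl ⟨(1, 1), rfl⟩
    · exact Or.inr ⟨-1, rfl⟩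
    · exact Or.inr ⟨0, rfl⟩
    · exact Or.inl ⟨(1, 0), rfl⟩
    · exact Or.inr ⟨0, rfl⟩
    · exact Or.inr ⟨-1, rfl⟩
  · rw [aeval_detPoly, perPoly_two_eq, Matrix.det_fin_three]
    simp [M]

/-- **`pdc(per_2) = 3`** (`= 2² - 1`, Grenet's value), while `dc(per_2) = 2`. [folklore] -/
theorem detProjectionComplexity_perPoly_two : detProjectionComplexity (perPoly (Fin 2) ℂ) = 3 := by
  have h3 := isDetProjection_perPoly_two_three
  unfold detProjectionComplexity
  apply le_antisymm (Nat.sInf_le h3)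
  by_contra hlt
  push Not at hlt
  have hmem : sInf {m | IsDetProjection (perPoly (Fin 2) ℂ) m} ∈
      {m | IsDetProjection (perPoly (Fin 2) ℂ) m} := Nat.sInf_mem ⟨3, h3⟩
  exact not_isDetProjection_perPoly_two_of_le_two (by omega) hmem

/-- `dc(per_2) ≤ 2` (the affine matrix `[[x₀₀, -x₀₁], [x₁₀, x₁₁]]`, in tree). [folklore] -/
theorem determinantalComplexity_perPoly_two_le : determinantalComplexity (perPoly (Fin 2) ℂ) ≤ 2 :=
  determinantalComplexity_le_of_hasDetRepr Literature.Computability.Complexity.hasDetRepr_perPoly_fin_two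

/-! ## (b) Boundary lemma for stub 1 of line `birth`: the size blow-up is necessary -/

/-- **The size-preserving form of `stub_isDetProjection_of_hasDetRepr` is FALSE**: an affine
determinantal representation of size `m` need not yield a projection of `DET_m` (witness
`per_2`, `m = 2`).  Any proof of the stub must pay a blow-up (`(#σ+1)·m` in the birth line;
`pdc ≤ (#σ+1)·dc`). [folklore] -/
theorem not_isDetProjection_of_hasDetRepr_sameSize :
    ¬ (∀ {k : Type} [CommRing k] {σ : Type} [Fintype σ] (f : MvPolynomial σ k) (m : ℕ),
        HasDetRepr f m → IsDetProjection f m) := fun h =>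
  not_isDetProjection_perPoly_two_of_le_two le_rfl
    (h _ 2 Literature.Computability.Complexity.hasDetRepr_perPoly_fin_two)

/-! ## (c) Natural strengthening "pdc = dc on permanents" is false (at `n = 2`) -/

/-- **`pdc(per_n) = dc(per_n)` fails at `n = 2`** (`3 ≠ 2`), although it holds at `n = 0, 1, 3`
(`dc(per_3) = pdc(per_3) = 7`, ABV 2017 + Grenet).  So the affine bound cannot be transferred to
projections "for free" uniformly in `n`; whether `pdc(per_n) = dc(per_n)` for all `n ≥ 3` is open. [folklore] -/
theorem not_forall_pdc_eq_dc_perPoly :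
    ¬ ∀ n, detProjectionComplexity (perPoly (Fin n) ℂ) = determinantalComplexity (perPoly (Fin n) ℂ) := by
  intro h
  have h2 := h 2
  rw [detProjectionComplexity_perPoly_two] at h2
  have := determinantalComplexity_perPoly_two_le
  omega

/-! ## Degenerate instances `n = 0, 1`: no junk -/

/-- `per_0 = 1` is the empty determinant: `pdc(per_0) = 0`. [folklore] -/
theorem detProjectionComplexity_perPoly_zero : detProjectionComplexity (perPoly (Fin 0) ℂ) = 0 := by
  have h0 : IsDetProjection (perPoly (Fin 0) ℂ) 0 := by
    refine ⟨fun p => C 0, fun _ => Or.inr ⟨0, rfl⟩, ?_⟩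
    rw [aeval_detPoly, Matrix.det_isEmpty]
    simp [perPoly, Matrix.permanent]
  unfold detProjectionComplexity
  exact Nat.eq_zero_of_le_zero (Nat.sInf_le h0)

/-- `per_1 = x₀₀ = det (x₀₀)` and `per_1 ≠ 1`: `pdc(per_1) = 1`. [folklore] -/
theorem detProjectionComplexity_perPoly_one : detProjectionComplexity (perPoly (Fin 1) ℂ) = 1 := by
  have hper1 : perPoly (Fin 1) ℂ = X (0, 0) := by
    simp [perPoly, Matrix.permanent_unique, Matrix.mvPolynomialX_apply]
  have h1 : IsDetProjection (perPoly (Fin 1) ℂ) 1 := by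
    refine ⟨fun _ => X (0, 0), fun _ => Or.inl ⟨(0, 0), rfl⟩, ?_⟩
    rw [aeval_detPoly, Matrix.det_fin_one, Matrix.of_apply, hper1]
  have h0 : ¬ IsDetProjection (perPoly (Fin 1) ℂ) 0 := by
    rintro ⟨a, -, heq⟩
    rw [aeval_detPoly, Matrix.det_isEmpty, hper1] at heq
    have := congr_arg (eval fun _ => (0 : ℂ)) heq
    simp at this
  unfold detProjectionComplexity
  apply le_antisymm (Nat.sInf_le h1)
  by_contra hlt
  push Not at hlt
  have hmem : sInf {m | IsDetProjection (perPoly (Fin 1) ℂ) m} ∈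
      {m | IsDetProjection (perPoly (Fin 1) ℂ) m} := Nat.sInf_mem ⟨1, h1⟩
  have hz : sInf {m | IsDetProjection (perPoly (Fin 1) ℂ) m} = 0 := by omega
  rw [hz] at hmem
  exact h0 hmem

end Summit.ValiantsHypothesis.ValiantsHypothesis.Cruxes.PdcQpOfVp.Disproof
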